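import Literature.NumberTheory.EllipticCurves.WeierstrassAdditionProofs
import Literature.NumberTheory.EllipticCurves.WeierstrassZetaLegendre
import Literature.NumberTheory.EllipticCurves.NeronSigmaFunctionAnalyticProofs
import Literature.NumberTheory.EllipticCurves.WeierstrassSigmaQProductProofs
import Literature.NumberTheory.EllipticCurves.GaussianLatticeQuarterValues
import HarnessLib

/-!
# Klein forms (Kubert–Lang)

Topic `Literature/NumberTheory/ModularForms`. For a period lattice `L` (Mathlib's `PeriodPair`, with
the tree's Weierstrass `σ` (`PeriodPair.weierstrassSigma`), Weierstrass `ζ`, quasi-periods `η₁, η₂` and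
the `ℝ`-linear quasi-period map `η(z; L)` (`PeriodPair.quasiPeriodMap`)) the **Klein form** is

  `𝔨(z; L) = exp(−η(z; L)·z/2) · σ(z; L)`

(S. Lang, *Elliptic Functions*, 2nd ed., Ch. 19 §1; D. Kubert, S. Lang, *Modular Units*, Ch. 2 §1),
and for a row vector `a = (a₁, a₂) ∈ ℝ²` and `τ ∈ ℍ` one puts `𝔨_a(τ) = 𝔨(a₁τ + a₂; ℤτ + ℤ)`.
We prove the formalism "K0–K3" of loc. cit. and the `q`-product:

* `PeriodPair.weierstrassZeta_add_eq_add_quasiPeriodMap`, `PeriodPair.weierstrassSigma_add_int_mul_add_int_mul`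
  — `ζ(z + ω) = ζ(z) + η(ω)` and the general quasi-periodicity
  `σ(z + mω₁ + nω₂) = (−1)^{m+n+mn} e^{η(ω)(z + ω/2)} σ(z)` (Lang, Ch. 18 §1 / Ch. 19 §1; the sign
  `(−1)^{mn}` is Legendre's relation);
* `PeriodPair.weierstrassSigma_congr_lattice`, `PeriodPair.quasiPeriodMap_congr_lattice`,
  `PeriodPair.kleinForm_congr_lattice` — `σ`, `η` and `𝔨` depend only on the lattice (`ζ`: the tree's
  `GaussianLattice.weierstrassZeta_eq_of_lattice_eq`);
* `PeriodPair.kleinForm_mulLeft` — **K0** `𝔨(λz; λL) = λ𝔨(z; L)`; `kleinForm_eq_zero_iff` (zeros = `Λ`);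
* `PeriodPair.kleinForm_add_int_mul_add_int_mul`, `PeriodPair.kleinForm_real_add_int_mul_add_int_mul` —
  the translation formula behind **K2**: `𝔨(z + ω) = (−1)^{m+n+mn} e^{(η(ω)z − η(z)ω)/2} 𝔨(z)`, and
  `η(ω)z − η(z)ω = (ma₂ − na₁)(η₁ω₂ − η₂ω₁)` at `z = a₁ω₁ + a₂ω₂`;
* `kleinFormH a τ = 𝔨(a₀τ + a₁; ℤτ + ℤ)` and **K1** `kleinFormH_smul`:
  `𝔨_a(γτ) = (cτ + d)⁻¹ 𝔨_{aγ}(τ)` for `γ ∈ SL₂(ℤ)` (via `ofUpperHalfPlane_smul_lattice_eq`: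
  `Λ_{γτ} = (cτ+d)⁻¹Λ_τ`); **K2** `kleinFormH_add_intCast`:
  `𝔨_{a+b}(τ) = (−1)^{b₀+b₁+b₀b₁} e^{−πi(b₀a₁ − b₁a₀)} 𝔨_a(τ)` for `b ∈ ℤ²`;
* **K4** `kleinFormH_eq_qProduct`: `𝔨_a(τ) = −(2πi)⁻¹ e^{πi(a₀−1)(a₀τ+a₁)} (1 − q_z) ∏_{n≥1}
  (1 − qⁿq_z)(1 − qⁿ/q_z)(1 − qⁿ)⁻²`, `q = e^{2πiτ}`, `q_z = e^{2πi(a₀τ+a₁)}` (from the tree's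
  `q`-product of `σ`, Silverman ATAEC I.6.4, and Legendre `η₂τ − η₁ = 2πi`).

Everything is proved; the definitions (`PeriodPair.kleinForm`, `kleinFormH`) have bodies; no named
facts. These are the input of the modularity of the Siegel units `g_a = 𝔨_a Δ^{1/12}`
(`SiegelUnits.lean`).

## References

* [Lang1987] S. Lang, *Elliptic Functions*, 2nd ed., GTM 112, Springer (1987), Ch. 18 §1
  (`σ(z + ω) = ψ(ω) e^{η(ω)(z+ω/2)} σ(z)`, `q`-product of `σ`), Ch. 19 §1 (Klein forms: K0, K1, K2,
  K3, Thm. 1), §2 (S1, Thm. 2).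
* [KubertLang1981] D. S. Kubert, S. Lang, *Modular Units*, Grundlehren 244, Springer (1981),
  Ch. 2 §1 (K1–K4).
* [Silverman1994] J. H. Silverman, *Advanced Topics in the Arithmetic of Elliptic Curves*,
  Thm. I.6.4 (`q`-product of `σ`), Prop. VI.3.1.
-/

noncomputable section

open Complex

open scoped Real UpperHalfPlane MatrixGroups

namespace PeriodPair

variable (L : PeriodPair)

/-! ### `σ`, `ζ`, `η` depend only on the lattice -/

/-- `σ` only depends on the lattice. [folklore] -/
theorem weierstrassSigma_congr_lattice {L L' : PeriodPair} (h : L.lattice = L'.lattice) :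
    L.weierstrassSigma = L'.weierstrassSigma := by
  ext z
  simp only [weierstrassSigma]
  congr 1
  exact (Equiv.subtypeEquivProp congr(($h : Set ℂ))).tprod_eq
    fun l : L'.lattice ↦ sigmaFactor z l

/-! ### `ζ(z + ω) = ζ(z) + η(ω)` for every lattice vector `ω` -/

/-- `η(mω₁ + nω₂) = mη₁ + nη₂` for integers `m, n`. [cite: Silverman1994, Prop VI.3.1] -/
theorem quasiPeriodMap_int_mul_add_int_mul (m n : ℤ) :
    L.quasiPeriodMap (m * L.ω₁ + n * L.ω₂) = m * L.η₁ + n * L.η₂ := by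
  have h := L.quasiPeriodMap_smul_add_smul (m : ℝ) (n : ℝ)
  simpa using h

/-- **`ζ(z + ω) = ζ(z) + η(ω)` for every `ω ∈ Λ`** and every `z` (`η` the `ℝ`-linear quasi-period
map: on the lattice it is the quasi-period homomorphism). Whittaker–Watson §20.41; Lang, *Elliptic
Functions*, Ch. 18 §1. [cite: WhittakerWatson1927, §20.41] -/
theorem weierstrassZeta_add_eq_add_quasiPeriodMap {ω : ℂ} (hω : ω ∈ L.lattice) (z : ℂ) :
    L.weierstrassZeta (z + ω) = L.weierstrassZeta z + L.quasiPeriodMap ω := by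
  obtain ⟨m, n, rfl⟩ := mem_lattice.mp hω
  rw [quasiPeriodMap_int_mul_add_int_mul, L.weierstrassZeta_add_period]

/-- The `ℝ`-linear quasi-period map only depends on the lattice (both maps are `ℝ`-linear and agree
with `ω ↦ ζ(z + ω) − ζ(z)` on a basis of the lattice, which is an `ℝ`-basis of `ℂ`). [folklore] -/
theorem quasiPeriodMap_congr_lattice {L L' : PeriodPair} (h : L.lattice = L'.lattice) :
    L.quasiPeriodMap = L'.quasiPeriodMap := by
  have key : ∀ ω : ℂ, ω ∈ L'.lattice → L.quasiPeriodMap ω = L'.quasiPeriodMap ω := by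
    intro ω hω
    have h1 := L.weierstrassZeta_add_eq_add_quasiPeriodMap (h ▸ hω) 0
    have h2 := L'.weierstrassZeta_add_eq_add_quasiPeriodMap hω 0
    rw [Literature.NumberTheory.EllipticCurves.GaussianLattice.weierstrassZeta_eq_of_lattice_eq h] at h1
    linear_combination h2 - h1
  apply L'.basis.ext
  intro i
  fin_cases i
  · simpa using key _ L'.ω₁_mem_lattice
  · simpa using key _ L'.ω₂_mem_lattice

/-! ### The general quasi-periodicity of `σ` -/

/-- `e^{mn(η₂ω₁ − η₁ω₂)/2} = (−1)^{mn}`: Legendre's relation `η₁ω₂ − η₂ω₁ = ±2πi`.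
[cite: WhittakerWatson1927, §20.411] -/
theorem cexp_int_mul_legendre_div_two (k : ℤ) :
    cexp (k * (L.η₂ * L.ω₁ - L.η₁ * L.ω₂) / 2) = (-1 : ℂ) ^ k := by
  rcases L.legendre_relation_up_to_sign with h | h
  · rw [show L.η₂ * L.ω₁ - L.η₁ * L.ω₂ = -(2 * Real.pi * I) by rw [← h]; ring,
      show (k : ℂ) * -(2 * ↑Real.pi * I) / 2 = k * (-(Real.pi * I)) by ring, Complex.exp_int_mul,
      Complex.exp_neg, Complex.exp_pi_mul_I, inv_neg, inv_one]
  · rw [h, show (k : ℂ) * (2 * ↑Real.pi * I) / 2 = k * (Real.pi * I) by ring, Complex.exp_int_mul,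
      Complex.exp_pi_mul_I]

/-- From a one-step law `σ(z + ω) = −e^{e(z + ω/2)}σ(z)` (Whittaker–Watson §20.421 for
`ω = ωᵢ`, `e = ηᵢ`): the law for all integer multiples,
`σ(z + mω) = (−1)^m e^{me(z + mω/2)} σ(z)`. [cite: WhittakerWatson1927, §20.421] -/
theorem weierstrassSigma_add_int_mul_of_step {ω e : ℂ}
    (hstep : ∀ z : ℂ, L.weierstrassSigma (z + ω) = -cexp (e * (z + ω / 2)) * L.weierstrassSigma z)
    (m : ℤ) (z : ℂ) :
    L.weierstrassSigma (z + m * ω) =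
      (-1 : ℂ) ^ m * cexp (m * e * (z + m * ω / 2)) * L.weierstrassSigma z := by
  have hsub : ∀ z : ℂ, L.weierstrassSigma (z - ω) =
      -cexp (-(e * (z - ω / 2))) * L.weierstrassSigma z := by
    intro z
    have h := hstep (z - ω)
    rw [sub_add_cancel, show z - ω + ω / 2 = z - ω / 2 by ring] at h
    rw [h, Complex.exp_neg]
    field_simp
  induction m using Int.induction_on generalizing z with
  | zero => simp
  | succ k ih =>
    have h1 := hstep (z + ((k : ℤ) : ℂ) * ω)
    rw [show z + ((k : ℤ) : ℂ) * ω + ω = z + (((k : ℤ) + 1 : ℤ) : ℂ) * ω by push_cast; ring] at h1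
    have hexp : cexp (e * (z + ((k : ℤ) : ℂ) * ω + ω / 2)) *
        cexp (((k : ℤ) : ℂ) * e * (z + ((k : ℤ) : ℂ) * ω / 2)) =
        cexp ((((k : ℤ) + 1 : ℤ) : ℂ) * e * (z + (((k : ℤ) + 1 : ℤ) : ℂ) * ω / 2)) := by
      rw [← Complex.exp_add]; congr 1; push_cast; ring
    rw [h1, ih, zpow_add₀ (by norm_num : (-1 : ℂ) ≠ 0), zpow_one, ← hexp]
    ring
  | pred k ih =>
    have h1 := hsub (z + ((-(k : ℤ) : ℤ) : ℂ) * ω)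
    rw [show z + ((-(k : ℤ) : ℤ) : ℂ) * ω - ω = z + ((-(k : ℤ) - 1 : ℤ) : ℂ) * ω by push_cast; ring]
      at h1
    have hexp : cexp (-(e * (z + ((-(k : ℤ) : ℤ) : ℂ) * ω - ω / 2))) *
        cexp (((-(k : ℤ) : ℤ) : ℂ) * e * (z + ((-(k : ℤ) : ℤ) : ℂ) * ω / 2)) =
        cexp (((-(k : ℤ) - 1 : ℤ) : ℂ) * e * (z + ((-(k : ℤ) - 1 : ℤ) : ℂ) * ω / 2)) := by
      rw [← Complex.exp_add]; congr 1; push_cast; ring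
    rw [h1, ih, show (-(k : ℤ) - 1 : ℤ) = -(k : ℤ) + (-1) by ring,
      zpow_add₀ (by norm_num : (-1 : ℂ) ≠ 0), zpow_neg_one, inv_neg, inv_one,
      show (-(k : ℤ) + -1 : ℤ) = -(k : ℤ) - 1 by ring, ← hexp]
    ring

/-- `σ(z + mω₁) = (−1)^m e^{mη₁(z + mω₁/2)} σ(z)` for every integer `m`.
[cite: WhittakerWatson1927, §20.421] -/
theorem weierstrassSigma_add_int_mul_ω₁ (m : ℤ) (z : ℂ) :
    L.weierstrassSigma (z + m * L.ω₁) =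
      (-1 : ℂ) ^ m * cexp (m * L.η₁ * (z + m * L.ω₁ / 2)) * L.weierstrassSigma z :=
  L.weierstrassSigma_add_int_mul_of_step L.weierstrassSigma_add_ω₁_holds m z

/-- `σ(z + nω₂) = (−1)^n e^{nη₂(z + nω₂/2)} σ(z)` for every integer `n`.
[cite: WhittakerWatson1927, §20.421] -/
theorem weierstrassSigma_add_int_mul_ω₂ (n : ℤ) (z : ℂ) :
    L.weierstrassSigma (z + n * L.ω₂) =
      (-1 : ℂ) ^ n * cexp (n * L.η₂ * (z + n * L.ω₂ / 2)) * L.weierstrassSigma z :=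
  L.weierstrassSigma_add_int_mul_of_step L.weierstrassSigma_add_ω₂_holds n z

/-- **The general quasi-periodicity of `σ`**: for `ω = mω₁ + nω₂`,
`σ(z + ω) = (−1)^{m+n+mn} e^{η(ω)(z + ω/2)} σ(z)` (Lang, *Elliptic Functions*, Ch. 18 §1, Thm. 1.4 /
Ch. 19 §1: "`σ(z + ω, L) = (−1)^{b₁b₂+b₁+b₂} e^{η(ω,L)(z+ω/2)} σ(z, L)`"; the sign `(−1)^{mn}` is
Legendre's relation). [cite: Lang1987, Ch. 19 §1] [cite: WhittakerWatson1927, §20.421, §20.411] -/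
theorem weierstrassSigma_add_int_mul_add_int_mul (m n : ℤ) (z : ℂ) :
    L.weierstrassSigma (z + (m * L.ω₁ + n * L.ω₂)) =
      (-1 : ℂ) ^ (m + n + m * n) *
        cexp ((m * L.η₁ + n * L.η₂) * (z + (m * L.ω₁ + n * L.ω₂) / 2)) * L.weierstrassSigma z := by
  rw [show z + (m * L.ω₁ + n * L.ω₂) = (z + m * L.ω₁) + n * L.ω₂ by ring,
    weierstrassSigma_add_int_mul_ω₂, weierstrassSigma_add_int_mul_ω₁]
  have hL := L.cexp_int_mul_legendre_div_two (m * n)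
  have hexp : cexp (↑n * L.η₂ * (z + ↑m * L.ω₁ + ↑n * L.ω₂ / 2)) * cexp (↑m * L.η₁ * (z + ↑m * L.ω₁ / 2)) =
      cexp (((m * n : ℤ) : ℂ) * (L.η₂ * L.ω₁ - L.η₁ * L.ω₂) / 2) *
        cexp ((↑m * L.η₁ + ↑n * L.η₂) * (z + (↑m * L.ω₁ + ↑n * L.ω₂) / 2)) := by
    rw [← Complex.exp_add, ← Complex.exp_add]; congr 1; push_cast; ring
  have h1 : (-1 : ℂ) ^ (m + n + m * n) = (-1) ^ n * (-1) ^ m * (-1) ^ (m * n) := by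
    rw [zpow_add₀ (by norm_num : (-1 : ℂ) ≠ 0), zpow_add₀ (by norm_num : (-1 : ℂ) ≠ 0)]; ring
  rw [h1, ← hL]
  calc (-1 : ℂ) ^ n * cexp (↑n * L.η₂ * (z + ↑m * L.ω₁ + ↑n * L.ω₂ / 2)) *
        ((-1) ^ m * cexp (↑m * L.η₁ * (z + ↑m * L.ω₁ / 2)) * L.weierstrassSigma z)
      = (-1 : ℂ) ^ n * (-1) ^ m * (cexp (↑n * L.η₂ * (z + ↑m * L.ω₁ + ↑n * L.ω₂ / 2)) *
          cexp (↑m * L.η₁ * (z + ↑m * L.ω₁ / 2))) * L.weierstrassSigma z := by ring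
    _ = _ := by rw [hexp]; ring

/-- The same with `η(ω)` written through the quasi-period map: for `ω ∈ Λ` there is a sign
`s = ±1` with `σ(z + ω) = s·e^{η(ω)(z + ω/2)} σ(z)` for all `z`. [cite: Lang1987, Ch. 19 §1] -/
theorem exists_sign_weierstrassSigma_add_of_mem_lattice {ω : ℂ} (hω : ω ∈ L.lattice) :
    ∃ s : ℂ, s ^ 2 = 1 ∧ ∀ z : ℂ, L.weierstrassSigma (z + ω) =
      s * cexp (L.quasiPeriodMap ω * (z + ω / 2)) * L.weierstrassSigma z := by
  obtain ⟨m, n, rfl⟩ := mem_lattice.mp hω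
  refine ⟨(-1 : ℂ) ^ (m + n + m * n), ?_, fun z => ?_⟩
  · rw [← zpow_natCast, ← zpow_mul, mul_comm, zpow_mul]; norm_num
  · rw [quasiPeriodMap_int_mul_add_int_mul, weierstrassSigma_add_int_mul_add_int_mul]

/-! ### The Klein form of a lattice -/

/-- The **Klein form** `𝔨(z; L) = exp(−η(z; L) z/2)·σ(z; L)` of a period lattice (Lang, *Elliptic
Functions*, Ch. 19 §1; Kubert–Lang, *Modular Units*, Ch. 2 §1), with `η(·; L)` the `ℝ`-linear
quasi-period map `PeriodPair.quasiPeriodMap` and `σ` the tree's `PeriodPair.weierstrassSigma`.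
A deliberate dot-notation extension of Mathlib's `PeriodPair`. [cite: Lang1987, Ch. 19 §1]
[cite: KubertLang1981, Ch. 2 §1] -/
def kleinForm (z : ℂ) : ℂ :=
  cexp (-(L.quasiPeriodMap z * z / 2)) * L.weierstrassSigma z

/-- Unfolding lemma for the Klein form. [cite: Lang1987, Ch. 19 §1] -/
theorem kleinForm_def (z : ℂ) :
    L.kleinForm z = cexp (-(L.quasiPeriodMap z * z / 2)) * L.weierstrassSigma z := rfl

/-- The Klein form only depends on the lattice. [cite: Lang1987, Ch. 19 §1] -/
theorem kleinForm_congr_lattice {L L' : PeriodPair} (h : L.lattice = L'.lattice) :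
    L.kleinForm = L'.kleinForm := by
  ext z
  rw [kleinForm_def, kleinForm_def, quasiPeriodMap_congr_lattice h, weierstrassSigma_congr_lattice h]

/-- **K0 (homogeneity of degree one)**: `𝔨(cz; cL) = c·𝔨(z; L)` for `c ≠ 0` (Lang, *Elliptic
Functions*, Ch. 19 §1, K0: "`𝔨(λz, λL) = λ𝔨(z, L)`", from the homogeneity of `σ` (degree `1`) and of
`η` (degree `−1`)). [cite: Lang1987, Ch. 19 §1, K0] -/
theorem kleinForm_mulLeft {c : ℂ} (hc : c ≠ 0) (z : ℂ) :
    (L.mulLeft c hc).kleinForm (c * z) = c * L.kleinForm z := by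
  rw [kleinForm_def, kleinForm_def, L.quasiPeriodMap_mulLeft hc, L.weierstrassSigma_mulLeft hc]
  rw [show -(c⁻¹ * L.quasiPeriodMap z * (c * z) / 2) = -(L.quasiPeriodMap z * z / 2) by
    field_simp]
  ring

/-- The Klein form is odd: `𝔨(−z) = −𝔨(z)`. [cite: KubertLang1981, Ch. 2 §1] -/
theorem kleinForm_neg (z : ℂ) : L.kleinForm (-z) = -L.kleinForm z := by
  rw [kleinForm_def, kleinForm_def, quasiPeriodMap_neg, weierstrassSigma_neg]
  ring_nf

/-- The Klein form vanishes exactly on the lattice. [cite: Lang1987, Ch. 19 §1] -/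
theorem kleinForm_eq_zero_iff (z : ℂ) : L.kleinForm z = 0 ↔ z ∈ L.lattice := by
  rw [kleinForm_def, mul_eq_zero, L.weierstrassSigma_eq_zero_iff_holds z]
  simp [Complex.exp_ne_zero]

/-- The Klein form has no zero off the lattice. [cite: Lang1987, Ch. 19 §1] -/
theorem kleinForm_ne_zero {z : ℂ} (hz : z ∉ L.lattice) : L.kleinForm z ≠ 0 := fun h =>
  hz ((L.kleinForm_eq_zero_iff z).mp h)

/-- **The translation formula (K2 at the level of the lattice)**: for `ω = mω₁ + nω₂ ∈ Λ`,
`𝔨(z + ω) = (−1)^{m+n+mn} exp((η(ω)z − η(z)ω)/2) 𝔨(z)` (Lang, *Elliptic Functions*, Ch. 19 §1,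
proof of K2, from the quasi-periodicity of `σ`). [cite: Lang1987, Ch. 19 §1, K2] -/
theorem kleinForm_add_int_mul_add_int_mul (m n : ℤ) (z : ℂ) :
    L.kleinForm (z + (m * L.ω₁ + n * L.ω₂)) =
      (-1 : ℂ) ^ (m + n + m * n) *
        cexp (((m * L.η₁ + n * L.η₂) * z - L.quasiPeriodMap z * (m * L.ω₁ + n * L.ω₂)) / 2) *
          L.kleinForm z := by
  rw [kleinForm_def, kleinForm_def, map_add, quasiPeriodMap_int_mul_add_int_mul,
    weierstrassSigma_add_int_mul_add_int_mul]
  have hexp : cexp (-((L.quasiPeriodMap z + (↑m * L.η₁ + ↑n * L.η₂)) * (z + (↑m * L.ω₁ + ↑n * L.ω₂)) / 2)) *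
      cexp ((↑m * L.η₁ + ↑n * L.η₂) * (z + (↑m * L.ω₁ + ↑n * L.ω₂) / 2)) =
      cexp (((↑m * L.η₁ + ↑n * L.η₂) * z - L.quasiPeriodMap z * (↑m * L.ω₁ + ↑n * L.ω₂)) / 2) *
        cexp (-(L.quasiPeriodMap z * z / 2)) := by
    rw [← Complex.exp_add, ← Complex.exp_add]; congr 1; ring
  calc cexp (-((L.quasiPeriodMap z + (↑m * L.η₁ + ↑n * L.η₂)) * (z + (↑m * L.ω₁ + ↑n * L.ω₂)) / 2)) *
        ((-1) ^ (m + n + m * n) * cexp ((↑m * L.η₁ + ↑n * L.η₂) * (z + (↑m * L.ω₁ + ↑n * L.ω₂) / 2)) *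
          L.weierstrassSigma z)
      = (-1) ^ (m + n + m * n) * (cexp (-((L.quasiPeriodMap z + (↑m * L.η₁ + ↑n * L.η₂)) *
          (z + (↑m * L.ω₁ + ↑n * L.ω₂)) / 2)) *
          cexp ((↑m * L.η₁ + ↑n * L.η₂) * (z + (↑m * L.ω₁ + ↑n * L.ω₂) / 2))) *
            L.weierstrassSigma z := by ring
    _ = _ := by rw [hexp]; ring

/-- The translation formula at a real point `z = a₁ω₁ + a₂ω₂` of the period parallelogram
coordinates: `η(ω)z − η(z)ω = (ma₂ − na₁)(η₁ω₂ − η₂ω₁)`, so that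
`𝔨(z + ω) = (−1)^{m+n+mn} exp((ma₂ − na₁)(η₁ω₂ − η₂ω₁)/2) 𝔨(z)` — by Legendre's relation the
exponential is `exp(∓πi(ma₂ − na₁))` (Lang, *Elliptic Functions*, Ch. 19 §1, K2:
"`ε(a, b) = (−1)^{b₁b₂+b₁+b₂} e^{−2πi(b₁a₂ − b₂a₁)/2}` … follows easily from the Legendre relation").
[cite: Lang1987, Ch. 19 §1, K2] -/
theorem kleinForm_real_add_int_mul_add_int_mul (a₁ a₂ : ℝ) (m n : ℤ) :
    L.kleinForm ((a₁ : ℂ) * L.ω₁ + (a₂ : ℂ) * L.ω₂ + (m * L.ω₁ + n * L.ω₂)) =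
      (-1 : ℂ) ^ (m + n + m * n) *
        cexp ((m * a₂ - n * a₁) * (L.η₁ * L.ω₂ - L.η₂ * L.ω₁) / 2) *
          L.kleinForm ((a₁ : ℂ) * L.ω₁ + (a₂ : ℂ) * L.ω₂) := by
  rw [kleinForm_add_int_mul_add_int_mul, quasiPeriodMap_smul_add_smul]
  congr 3
  ring

end PeriodPair

/-! ## Klein forms on the upper half plane: `𝔨_a(τ) = 𝔨(a₁τ + a₂; ℤτ + ℤ)` -/

namespace Literature.NumberTheory.ModularForms

open PeriodPair
open UpperHalfPlane hiding I
open Literature.NumberTheory.EllipticCurves (weierstrassSigma_ofUpperHalfPlane_eq_qProduct_holds)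

/-- The **Klein form `𝔨_a(τ)`** of a row vector `a = (a₁, a₂) ∈ ℝ²` at `τ ∈ ℍ`:
`𝔨_a(τ) = 𝔨(a₁τ + a₂; ℤτ + ℤ)` (Lang, *Elliptic Functions*, Ch. 19 §1, with `W_τ = (τ, 1)`;
Kubert–Lang, *Modular Units*, Ch. 2 §1). [cite: Lang1987, Ch. 19 §1] [cite: KubertLang1981, Ch. 2 §1] -/
def kleinFormH (a : Fin 2 → ℝ) (τ : ℍ) : ℂ :=
  (ofUpperHalfPlane τ).kleinForm ((a 0 : ℂ) * τ + a 1)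

/-- Unfolding lemma for `𝔨_a(τ)`. [cite: Lang1987, Ch. 19 §1] -/
theorem kleinFormH_def (a : Fin 2 → ℝ) (τ : ℍ) :
    kleinFormH a τ = (ofUpperHalfPlane τ).kleinForm ((a 0 : ℂ) * τ + a 1) := rfl

/-- Legendre's relation for `Λ_τ = ℤτ + ℤ`: `η₂τ − η₁ = 2πi` (`η₁ = η(τ)`, `η₂ = η(1)`).
[cite: WhittakerWatson1927, §20.411] -/
theorem eta_two_mul_sub_eta_one (τ : ℍ) :
    (ofUpperHalfPlane τ).η₂ * τ - (ofUpperHalfPlane τ).η₁ = 2 * π * I := by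
  have h := (ofUpperHalfPlane τ).legendre_relation_of_neg
    (by simpa [ofUpperHalfPlane_ω₁, ofUpperHalfPlane_ω₂] using τ.im_pos)
  simpa [ofUpperHalfPlane_ω₁, ofUpperHalfPlane_ω₂] using h

/-- `cτ + d ≠ 0` for the bottom row of `γ ∈ SL₂(ℤ)`. [folklore] -/
theorem sl_denom_ne_zero (γ : SL(2, ℤ)) (τ : ℍ) : ((γ 1 0 : ℤ) : ℂ) * τ + ((γ 1 1 : ℤ) : ℂ) ≠ 0 := by
  have h := UpperHalfPlane.linear_ne_zero (cd := ![((γ 1 0 : ℤ) : ℝ), ((γ 1 1 : ℤ) : ℝ)]) τ (by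
    intro h0
    have h10' : ((γ 1 0 : ℤ) : ℝ) = 0 := by simpa using congrFun h0 0
    have h11' : ((γ 1 1 : ℤ) : ℝ) = 0 := by simpa using congrFun h0 1
    have h10 : (γ 1 0 : ℤ) = 0 := by exact_mod_cast h10'
    have h11 : (γ 1 1 : ℤ) = 0 := by exact_mod_cast h11'
    have hdet := Matrix.det_fin_two (γ : Matrix (Fin 2) (Fin 2) ℤ)
    rw [γ.det_coe, h10, h11] at hdet
    simp at hdet)
  simpa using h

/-- The lattice of `γτ` is `(cτ + d)⁻¹ Λ_τ`: `ℤ·γτ + ℤ = (cτ+d)⁻¹(ℤτ + ℤ)` for `γ ∈ SL₂(ℤ)`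
(unimodular change of basis `(aτ + b, cτ + d)` of `Λ_τ`). [folklore] -/
theorem ofUpperHalfPlane_smul_lattice_eq (γ : SL(2, ℤ)) (τ : ℍ) :
    (ofUpperHalfPlane (γ • τ)).lattice =
      ((ofUpperHalfPlane τ).mulLeft (((γ 1 0 : ℤ) : ℂ) * τ + ((γ 1 1 : ℤ) : ℂ))⁻¹
        (inv_ne_zero (sl_denom_ne_zero γ τ))).lattice := by
  have hj0 : ((γ 1 0 : ℤ) : ℂ) * τ + ((γ 1 1 : ℤ) : ℂ) ≠ 0 := sl_denom_ne_zero γ τ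
  have hinv : (((γ 1 0 : ℤ) : ℂ) * τ + ((γ 1 1 : ℤ) : ℂ))⁻¹ * (((γ 1 0 : ℤ) : ℂ) * τ + ((γ 1 1 : ℤ) : ℂ)) = 1 :=
    inv_mul_cancel₀ hj0
  have hdet : (γ 0 0 : ℤ) * γ 1 1 - γ 0 1 * γ 1 0 = 1 := by
    have := Matrix.det_fin_two (γ : Matrix (Fin 2) (Fin 2) ℤ); rw [γ.det_coe] at this; linarith
  have hdetC : ((γ 0 0 : ℤ) : ℂ) * ((γ 1 1 : ℤ) : ℂ) - ((γ 0 1 : ℤ) : ℂ) * ((γ 1 0 : ℤ) : ℂ) = 1 := by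
    exact_mod_cast hdet
  have hcoe : ((γ • τ : ℍ) : ℂ) =
      (((γ 0 0 : ℤ) : ℂ) * τ + ((γ 0 1 : ℤ) : ℂ)) * (((γ 1 0 : ℤ) : ℂ) * τ + ((γ 1 1 : ℤ) : ℂ))⁻¹ := by
    rw [UpperHalfPlane.coe_specialLinearGroup_apply, div_eq_mul_inv]
    simp
  -- the two generating pairs
  have hω₁ : (ofUpperHalfPlane (γ • τ)).ω₁ =
      (((γ 0 0 : ℤ) : ℂ) * τ + ((γ 0 1 : ℤ) : ℂ)) * (((γ 1 0 : ℤ) : ℂ) * τ + ((γ 1 1 : ℤ) : ℂ))⁻¹ := by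
    rw [ofUpperHalfPlane_ω₁, hcoe]
  have hω₂ : (ofUpperHalfPlane (γ • τ)).ω₂ = 1 := ofUpperHalfPlane_ω₂ _
  have hω₁' : ((ofUpperHalfPlane τ).mulLeft (((γ 1 0 : ℤ) : ℂ) * τ + ((γ 1 1 : ℤ) : ℂ))⁻¹
      (inv_ne_zero hj0)).ω₁ = (((γ 1 0 : ℤ) : ℂ) * τ + ((γ 1 1 : ℤ) : ℂ))⁻¹ * τ := by
    rw [mulLeft_ω₁, ofUpperHalfPlane_ω₁]
  have hω₂' : ((ofUpperHalfPlane τ).mulLeft (((γ 1 0 : ℤ) : ℂ) * τ + ((γ 1 1 : ℤ) : ℂ))⁻¹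
      (inv_ne_zero hj0)).ω₂ = (((γ 1 0 : ℤ) : ℂ) * τ + ((γ 1 1 : ℤ) : ℂ))⁻¹ := by
    rw [mulLeft_ω₂, ofUpperHalfPlane_ω₂, mul_one]
  apply le_antisymm
  · rw [lattice, Submodule.span_le]
    rintro x hx
    simp only [Set.mem_insert_iff, Set.mem_singleton_iff] at hx
    rw [SetLike.mem_coe, mem_lattice, hω₁', hω₂']
    rcases hx with rfl | rfl
    · exact ⟨γ 0 0, γ 0 1, by rw [hω₁]; ring⟩
    · exact ⟨γ 1 0, γ 1 1, by rw [hω₂]; linear_combination hinv⟩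
  · rw [lattice, Submodule.span_le]
    rintro x hx
    simp only [Set.mem_insert_iff, Set.mem_singleton_iff] at hx
    rw [SetLike.mem_coe, mem_lattice, hω₁, hω₂]
    rcases hx with rfl | rfl
    · refine ⟨γ 1 1, -(γ 0 1), ?_⟩
      rw [hω₁']
      push_cast
      linear_combination ((((γ 1 0 : ℤ) : ℂ) * τ + ((γ 1 1 : ℤ) : ℂ))⁻¹ * (τ : ℂ)) * hdetC +
        ((γ 0 1 : ℤ) : ℂ) * hinv
    · refine ⟨-(γ 1 0), γ 0 0, ?_⟩
      rw [hω₂']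
      push_cast
      linear_combination (((γ 1 0 : ℤ) : ℂ) * τ + ((γ 1 1 : ℤ) : ℂ))⁻¹ * hdetC -
        ((γ 0 0 : ℤ) : ℂ) * hinv

/-- **K1 (transformation under `SL₂(ℤ)`)**: `𝔨_a(γτ) = (cτ + d)⁻¹ 𝔨_{aγ}(τ)` for `γ = (a b; c d) ∈
SL₂(ℤ)`, `aγ` the row vector `(a₁a + a₂c, a₁b + a₂d)` (Lang, *Elliptic Functions*, Ch. 19 §1, K1:
"`𝔨_a(αW) = 𝔨_{aα}(W)`" for `W = (ω₁, ω₂)`, with `αW_τ = (cτ + d)W_{ατ}` and the homogeneity K0).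
[cite: Lang1987, Ch. 19 §1, K1] [cite: KubertLang1981, Ch. 2 §1, K1] -/
theorem kleinFormH_smul (a : Fin 2 → ℝ) (γ : SL(2, ℤ)) (τ : ℍ) :
    kleinFormH a (γ • τ) =
      (((γ 1 0 : ℤ) : ℂ) * τ + ((γ 1 1 : ℤ) : ℂ))⁻¹ *
        kleinFormH ![a 0 * γ 0 0 + a 1 * γ 1 0, a 0 * γ 0 1 + a 1 * γ 1 1] τ := by
  have hj0 : ((γ 1 0 : ℤ) : ℂ) * τ + ((γ 1 1 : ℤ) : ℂ) ≠ 0 := sl_denom_ne_zero γ τ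
  have hcoe : ((γ • τ : ℍ) : ℂ) =
      (((γ 0 0 : ℤ) : ℂ) * τ + ((γ 0 1 : ℤ) : ℂ)) * (((γ 1 0 : ℤ) : ℂ) * τ + ((γ 1 1 : ℤ) : ℂ))⁻¹ := by
    rw [UpperHalfPlane.coe_specialLinearGroup_apply, div_eq_mul_inv]
    simp
  rw [kleinFormH_def, kleinFormH_def, kleinForm_congr_lattice (ofUpperHalfPlane_smul_lattice_eq γ τ)]
  have hz : (a 0 : ℂ) * ((γ • τ : ℍ) : ℂ) + a 1 = (((γ 1 0 : ℤ) : ℂ) * τ + ((γ 1 1 : ℤ) : ℂ))⁻¹ *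
      (((a 0 * γ 0 0 + a 1 * γ 1 0 : ℝ) : ℂ) * τ + ((a 0 * γ 0 1 + a 1 * γ 1 1 : ℝ) : ℂ)) := by
    rw [hcoe]
    have hinv : (((γ 1 0 : ℤ) : ℂ) * τ + ((γ 1 1 : ℤ) : ℂ))⁻¹ * (((γ 1 0 : ℤ) : ℂ) * τ + ((γ 1 1 : ℤ) : ℂ)) = 1 :=
      inv_mul_cancel₀ hj0
    push_cast
    linear_combination (-(a 1 : ℂ)) * hinv
  rw [hz, kleinForm_mulLeft]
  simp

/-- The same with Mathlib's row-vector action `a ᵥ* γ`. [cite: Lang1987, Ch. 19 §1, K1] -/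
theorem kleinFormH_smul' (a : Fin 2 → ℝ) (γ : SL(2, ℤ)) (τ : ℍ) :
    kleinFormH a (γ • τ) =
      (((γ 1 0 : ℤ) : ℂ) * τ + ((γ 1 1 : ℤ) : ℂ))⁻¹ *
        kleinFormH (Matrix.vecMul a ((γ : Matrix (Fin 2) (Fin 2) ℤ).map (Int.cast : ℤ → ℝ))) τ := by
  rw [kleinFormH_smul]
  congr 2
  ext i
  fin_cases i <;> simp [Matrix.vecMul, dotProduct, Fin.sum_univ_two]

/-- **K2 (translation by integer vectors)**: for `b ∈ ℤ²`,
`𝔨_{a+b}(τ) = (−1)^{b₁+b₂+b₁b₂} e^{−πi(b₁a₂ − b₂a₁)} 𝔨_a(τ)` (Lang, *Elliptic Functions*, Ch. 19 §1,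
K2: "`𝔨_{a+b}(W) = ε(a,b)𝔨_a(W)`, `ε(a, b) = (−1)^{b₁b₂+b₁+b₂} e^{−2πi(b₁a₂ − b₂a₁)/2}` … This
follows easily from the Legendre relation"). [cite: Lang1987, Ch. 19 §1, K2]
[cite: KubertLang1981, Ch. 2 §1, K2] -/
theorem kleinFormH_add_intCast (a : Fin 2 → ℝ) (b : Fin 2 → ℤ) (τ : ℍ) :
    kleinFormH (fun i => a i + b i) τ =
      (-1 : ℂ) ^ (b 0 + b 1 + b 0 * b 1) * cexp (-(π * I * (b 0 * a 1 - b 1 * a 0))) *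
        kleinFormH a τ := by
  rw [kleinFormH_def, kleinFormH_def]
  have hL := eta_two_mul_sub_eta_one τ
  have h := (ofUpperHalfPlane τ).kleinForm_real_add_int_mul_add_int_mul (a 0) (a 1) (b 0) (b 1)
  simp only [ofUpperHalfPlane_ω₁, ofUpperHalfPlane_ω₂, mul_one] at h
  rw [show ((a 0 + (b 0 : ℝ) : ℝ) : ℂ) * τ + ((a 1 + (b 1 : ℝ) : ℝ) : ℂ) =
      (a 0 : ℂ) * τ + a 1 + ((b 0 : ℤ) * τ + (b 1 : ℤ)) by push_cast; ring, h]
  have hXY : cexp ((↑(b 0) * ↑(a 1) - ↑(b 1) * ↑(a 0)) *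
      ((ofUpperHalfPlane τ).η₁ - (ofUpperHalfPlane τ).η₂ * ↑τ) / 2) =
      cexp (-(π * I * (b 0 * a 1 - b 1 * a 0))) := by
    congr 1
    rw [show (ofUpperHalfPlane τ).η₁ - (ofUpperHalfPlane τ).η₂ * τ = -(2 * π * I) by rw [← hL]; ring]
    ring
  rw [hXY]

/-- **K4 (the `q`-product)**: with `q = e^{2πiτ}`, `z = a₁τ + a₂`, `q_z = e^{2πiz}`,
`𝔨_a(τ) = −(2πi)⁻¹ e^{πi(a₁−1)z} (1 − q_z) ∏_{n≥1} (1 − qⁿq_z)(1 − qⁿ/q_z)(1 − qⁿ)⁻²`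
(Kubert–Lang, *Modular Units*, Ch. 2 §1, K4; Lang, *Elliptic Functions*, Ch. 19 §2, S1 for
`g_a = 𝔨_aη²`), from the `q`-product of `σ` (Silverman, *Advanced Topics*, Thm. I.6.4, the tree's
`weierstrassSigma_ofUpperHalfPlane_eq_qProduct_holds`) and Legendre's relation
`−η(z)z/2 + η₂z²/2 = πia₁z`. [cite: KubertLang1981, Ch. 2 §1, K4] [cite: Silverman1994, Thm I.6.4] -/
theorem kleinFormH_eq_qProduct (a : Fin 2 → ℝ) (τ : ℍ) :
    kleinFormH a τ =
      -(1 / (2 * π * I)) * cexp (π * I * (a 0 - 1) * ((a 0 : ℂ) * τ + a 1)) *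
        (1 - cexp (2 * π * I * ((a 0 : ℂ) * τ + a 1))) *
        ∏' n : ℕ, (1 - cexp (2 * π * I * τ) ^ (n + 1) * cexp (2 * π * I * ((a 0 : ℂ) * τ + a 1))) *
          (1 - cexp (2 * π * I * τ) ^ (n + 1) * (cexp (2 * π * I * ((a 0 : ℂ) * τ + a 1)))⁻¹) /
          (1 - cexp (2 * π * I * τ) ^ (n + 1)) ^ 2 := by
  rw [kleinFormH_def, kleinForm_def, weierstrassSigma_ofUpperHalfPlane_eq_qProduct_holds τ]
  have hη : (ofUpperHalfPlane τ).quasiPeriodMap ((a 0 : ℂ) * τ + a 1) =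
      (a 0 : ℂ) * (ofUpperHalfPlane τ).η₁ + (a 1 : ℂ) * (ofUpperHalfPlane τ).η₂ := by
    have h := (ofUpperHalfPlane τ).quasiPeriodMap_smul_add_smul (a 0) (a 1)
    simpa [ofUpperHalfPlane_ω₁, ofUpperHalfPlane_ω₂] using h
  have hL := eta_two_mul_sub_eta_one τ
  have hexp : cexp (-((ofUpperHalfPlane τ).quasiPeriodMap ((a 0 : ℂ) * τ + a 1) * ((a 0 : ℂ) * τ + a 1) / 2)) *
      (cexp (1 / 2 * (ofUpperHalfPlane τ).η₂ * ((a 0 : ℂ) * τ + a 1) ^ 2) *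
        cexp (-(π * I * ((a 0 : ℂ) * τ + a 1)))) =
      cexp (π * I * (a 0 - 1) * ((a 0 : ℂ) * τ + a 1)) := by
    rw [← Complex.exp_add, ← Complex.exp_add, hη]
    congr 1
    rw [show (ofUpperHalfPlane τ).η₁ = (ofUpperHalfPlane τ).η₂ * τ - 2 * π * I by rw [← hL]; ring]
    ring
  rw [← hexp]
  ring

end Literature.NumberTheory.ModularForms

end
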